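import Summits.ResolutionOfSingularities.ResolutionOfSingularities.Theorems.ResidueCutCells
import Summits.ResolutionOfSingularities.ResolutionOfSingularities.Theorems.MarkedTransferCampaignW13BypassRFlatFailure
import HarnessLib

/-!
# ResidueCutCertificates — decomp-res node «ResidueCut» (lens-2 g25, critic row 200 CLEARED MAP +1), tree file 3/4 of the node

Content VERBATIM from the decomp-res lens-2 g25 node `HOME/decomp-res-lens-2/g25/ResidueCut.lean` (pin 4d29427b; no
carry, imports the landed tree only; ns `…Theses.ResidueCut` ↦ `…Theorems.ResidueCut`); HOME =
run/shared/lean/pub/decomp-res; critic CRITIC-LEDGER row 200 CLEARED MAP +1; landing orders INBOX 08:49:37Z /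
08:52:28Z / 09:07:12Z — provenance, critic text and the lens header in full in the first file of the node,
`ResidueCutLaws`.  `--kind proof --supports stmt-ResolutionOfSingularities-29273`.

## This file

§7 RING LEVEL (kernel): `section RingLevel` — operators of order `≤ 1` are BLIND TO `p`-TH POWERS
(`apply_mul_pow_of_isDiffOpLE_one_of_cast_eq_zero`: `D (g·x^p) = x^p·D g`); `section Inhabitant` — the
inseparable-kind inhabitant `insepF = (t^p − a)² + u³ + v³` with `diffIdeal_one_sup_le` / `diffIdeal_one_insepF_le`
(NO `k`-contact along its top line `insepLine`, every `p`); `section Corner39` — the CONTROL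
`corner39_origin_contact` (corner39's origin carries a first Hasse derivative in `Diff^{≤1} ∩ 𝔪 ∖ 𝔪²`: a CONTACT
point, not special — erratum of rows 180(α)/184).  Mathlib `MvPolynomial` level over the tree's Hasse / diff-ideal API.

[WRITER NOTE (decomp-res writer g13): file split only (tree files ≤ 400 lines); sections, namespaces, section
`open`s and every declaration exactly as in the lens (the node's HOME-only dupNamespace-linter line is dropped; the
namespace-level `open` lines of the node are replayed in every part, the `open …Theses` line only in the Theses-cone
file `MaxContactCutResidueCut`); namespace renamed `…Theses.ResidueCut` ↦ `…Theorems.ResidueCut`; ONE dedup token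
change in THIS file: the lens's §7 ring lemma `apply_mul_of_isDiffOpLE_one` (Leibniz form of an operator of order ≤
1, 8 lines) restates the LANDED `Campaign.W13.apply_mul_of_isDiffOpLE_one`
(`Theorems/MarkedTransferCampaignW13BypassRFlatFailure`, binders `[CommSemiring R]` ⊇ the lens's `[CommRing R]`;
pre-flight `dedup.landed`) — the copy is DELETED, that module IMPORTED, and its two uses
(`apply_pow_succ_of_isDiffOpLE_one`, `apply_mul_pow_of_isDiffOpLE_one_of_cast_eq_zero`) cite
`Campaign.W13.apply_mul_of_isDiffOpLE_one`.]

(Sources: EGAIV4 Thm. 16.11.2; StacksProject 00TV; CossartPiltant2008 Prop. 4.2; VillamayorU2008ReesDiff §4.1;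
BierstoneGrigorievMilmanWlodarczyk2011 §3.1; Cutkosky2009; Hironaka1964 Ch. III; Kollar2007 Lemma 3.74; Hauser2003 §4.)
-/

open CategoryTheory AlgebraicGeometry TopologicalSpace IsLocalRing
open Literature.AlgebraicGeometry.Resolution
open Summit.ResolutionOfSingularities.ResolutionOfSingularities.Theorems
open Summit.ResolutionOfSingularities.ResolutionOfSingularities.Theorems.WeakOrderReduction
open Summit.ResolutionOfSingularities.ResolutionOfSingularities.Theorems.ForcedTowerClasses
open Summit.ResolutionOfSingularities.ResolutionOfSingularities.Theorems.CurveLeafExit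
open Summit.ResolutionOfSingularities.ResolutionOfSingularities.Theorems.PurityCut
open Summit.ResolutionOfSingularities.ResolutionOfSingularities.Theorems.AbsoluteContactClasses
open Summit.ResolutionOfSingularities.ResolutionOfSingularities.Theorems.DeltaFaceCutClasses
open Summit.ResolutionOfSingularities.ResolutionOfSingularities.Theorems.RelativeDeltaCut
open Summit.ResolutionOfSingularities.ResolutionOfSingularities.Theorems.DeepCrossCut
open Summit.ResolutionOfSingularities.ResolutionOfSingularities.Theorems.PinchCut
open Summit.ResolutionOfSingularities.ResolutionOfSingularities.Theorems.JetCut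
open Summit.ResolutionOfSingularities.ResolutionOfSingularities.Theorems.SplitCut
open Summit.ResolutionOfSingularities.ResolutionOfSingularities.Theorems.CylinderCut
open Summit.ResolutionOfSingularities.ResolutionOfSingularities.Theorems.SpreadCut
open Summit.ResolutionOfSingularities.ResolutionOfSingularities.Theorems.CrossCut
open Summit.ResolutionOfSingularities.ResolutionOfSingularities.Theorems.OddCrossCut

namespace Summit.ResolutionOfSingularities.ResolutionOfSingularities.Theorems.ResidueCut

section RingLevel

variable {R A : Type*} [CommRing R] [CommRing A] [Algebra R A]

/-! ## §7  RING LEVEL (kernel): operators of order `≤ 1` are BLIND TO `p`-TH POWERS; the ¬contact certificate of the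
inseparable-kind inhabitant `(t^p − a)² + u³ + v³`; the contact certificate of the tame pilot corner39 (critic row
197a (7): «at least ring level», with the residual-membership clause ARGUED in the docstrings) -/

/-- `D (x^{k+1}) = (k+1)·x^k·D x − k·x^{k+1}·D 1` for `D` of order `≤ 1`. KERNEL (PROVED). [folklore] -/
theorem apply_pow_succ_of_isDiffOpLE_one {D : A →ₗ[R] A} (hD : IsDiffOpLE R 1 D) (x : A) (k : ℕ) :
    D (x ^ (k + 1)) = ((k : A) + 1) * x ^ k * D x - (k : A) * x ^ (k + 1) * D 1 := by
  induction k with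
  | zero => simp
  | succ k ih =>
    rw [pow_succ, Campaign.W13.apply_mul_of_isDiffOpLE_one hD, ih]
    push_cast
    ring

/-- **ORDER-`≤ 1` OPERATORS ARE BLIND TO `p`-TH POWERS**: if `p = 0` in `A` then `D (x^p) = x^p · D 1` — in
characteristic `p` a `p`-th power behaves like a constant under every differential operator of order `≤ 1` (not only
under derivations). KERNEL (PROVED). (Sources: EGAIV4 Prop. 16.8.8; Kollar2007 Lemma 3.74.) -/
theorem apply_pow_of_isDiffOpLE_one_of_cast_eq_zero {D : A →ₗ[R] A} (hD : IsDiffOpLE R 1 D) {p : ℕ}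
    (hp0 : 0 < p) (hp : (p : A) = 0) (x : A) : D (x ^ p) = x ^ p * D 1 := by
  obtain ⟨k, rfl⟩ : ∃ k, p = k + 1 := ⟨p - 1, by omega⟩
  have hk : (k : A) = -1 := by
    have h' : ((k : A) + 1) = 0 := by exact_mod_cast hp
    linear_combination h'
  rw [apply_pow_succ_of_isDiffOpLE_one hD, hk]
  ring

/-- … hence `D (g · x^p) = x^p · D g`: multiplication by a `p`-th power COMMUTES with every operator of order `≤ 1`.
KERNEL (PROVED). [folklore] -/
theorem apply_mul_pow_of_isDiffOpLE_one_of_cast_eq_zero {D : A →ₗ[R] A} (hD : IsDiffOpLE R 1 D) {p : ℕ}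
    (hp0 : 0 < p) (hp : (p : A) = 0) (g x : A) : D (g * x ^ p) = x ^ p * D g := by
  rw [Campaign.W13.apply_mul_of_isDiffOpLE_one hD, apply_pow_of_isDiffOpLE_one_of_cast_eq_zero hD hp0 hp]
  ring

end RingLevel

section Inhabitant

open MvPolynomial
variable (K : Type) [Field K] (p : ℕ) (a : K)

/-- `T := t^p − a` on `𝔸⁴_K = Spec K[s, t, u, v]` (`s, t, u, v = X 0, X 1, X 2, X 3`).  With `K = 𝔽_p(a)`
(`a ∉ K^p`) the prime `𝔫 = (T, u, v)` is the TOP LINE of the inhabitant, its points have residue fields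
`⊇ K(a^{1/p})` — purely INSEPARABLE over `K`. DEFINITION (inhabitant). [folklore] -/
noncomputable def insepT : MvPolynomial (Fin 4) K := X 1 ^ p - C a

/-- **THE INSEPARABLE-KIND INHABITANT** `f = (t^p − a)² + u³ + v³` — marking `n = 2`, any `p` (the critic's
`T² + u³ + v³`, `T = t^p − a` over `𝔽_p(a)`, `p ≥ 5`; the certificate below holds for every `p`). DEFINITION. [folklore] -/
noncomputable def insepF : MvPolynomial (Fin 4) K := insepT K p a ^ 2 + X 2 ^ 3 + X 3 ^ 3

/-- The ideal `𝔫 = (t^p − a, u, v)` of the top line. DEFINITION. [folklore] -/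
noncomputable def insepLine : Ideal (MvPolynomial (Fin 4) K) := Ideal.span {insepT K p a, X 2, X 3}

/-- `insepT_mem_insepLine`: Auxiliary step of this node's calculus, VERBATIM from the lens file (see the module
docstring); the statement is its type. [folklore] -/
theorem insepT_mem_insepLine : insepT K p a ∈ insepLine K p a := Ideal.subset_span (by simp)

/-- `X_two_mem_insepLine`: Auxiliary step of this node's calculus, VERBATIM from the lens file (see the module
docstring); the statement is its type. [folklore] -/
theorem X_two_mem_insepLine : (X 2 : MvPolynomial (Fin 4) K) ∈ insepLine K p a := Ideal.subset_span (by simp)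

/-- `X_three_mem_insepLine`: Auxiliary step of this node's calculus, VERBATIM from the lens file (see the module
docstring); the statement is its type. [folklore] -/
theorem X_three_mem_insepLine : (X 3 : MvPolynomial (Fin 4) K) ∈ insepLine K p a := Ideal.subset_span (by simp)

/-- `f ∈ 𝔫²`: order `≥ 2` along the whole line `V(𝔫)` (and `= 2` exactly: `T` is part of a regular system of
parameters at every point of the line, `T̄²` is the initial form — `τ = 1`). KERNEL (PROVED). [folklore] -/
theorem insepF_mem_sq : insepF K p a ∈ insepLine K p a ^ 2 := by
  have h23 : insepLine K p a ^ 3 ≤ insepLine K p a ^ 2 := Ideal.pow_le_pow_right (by norm_num)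
  refine Ideal.add_mem _ (Ideal.add_mem _ ?_ (h23 ?_)) (h23 ?_)
  · exact Ideal.pow_mem_pow (insepT_mem_insepLine K p a) 2
  · exact Ideal.pow_mem_pow (X_two_mem_insepLine K p a) 3
  · exact Ideal.pow_mem_pow (X_three_mem_insepLine K p a) 3

/-- **Multiplication by `T = t^p − a` commutes with every `K`-linear operator of order `≤ 1`** (the blindness lemma +
`K`-linearity). KERNEL (PROVED). [folklore] -/
theorem apply_mul_insepT [hp : Fact p.Prime] [CharP K p] (D : MvPolynomial (Fin 4) K →ₗ[K] MvPolynomial (Fin 4) K)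
    (hD : IsDiffOpLE K 1 D) (g : MvPolynomial (Fin 4) K) : D (g * insepT K p a) = insepT K p a * D g := by
  have hpA : ((p : ℕ) : MvPolynomial (Fin 4) K) = 0 := CharP.cast_eq_zero _ p
  have hC : D (g * C a) = C a * D g := by
    rw [mul_comm g (C a), C_mul', map_smul, ← C_mul']
  rw [insepT, mul_sub, map_sub, apply_mul_pow_of_isDiffOpLE_one_of_cast_eq_zero hD hp.out.pos hpA, hC]
  ring

/-- **THE ¬CONTACT CERTIFICATE OF THE INHABITANT (ring level, kernel)**: `Diff^{≤ 1}_K((f)) ⊆ 𝔫²` for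
`f = (t^p − a)² + u³ + v³`, `𝔫 = (t^p − a, u, v)`.  PROOF: `g·f = (g T)·T + g·(u³ + v³)`; an operator `D` of order
`≤ 1` commutes with `T` twice (`apply_mul_insepT`), so `D((gT)T) = T²·D g ∈ 𝔫²`, and lowers the `𝔫`-adic order of
`g(u³ + v³) ∈ 𝔫³` by at most one (`IsDiffOpLE.apply_mem_pow_sub`).
SCHEME DICTIONARY (prose, standard): for `Y = 𝔸⁴_K`, `I = (f)`, `n = 2` and ANY point `y ⊇ 𝔫` (the generic point
`ζ` of the line or a closed point on it): `(Diff^{≤1}(I))_y = Diff^{≤1}((f))·𝒪_y ⊆ 𝔫²𝒪_y ⊆ 𝔪_y²` (differential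
operators of finite order localise; tree `stalkIdeal_diffIdealSheaf`), so NO germ of `Diff^{≤ n−1}(I)` at `y` has
order exactly one: `¬ IsContactPt g I 2 y`; `ord_y I = 2` (`f ∈ 𝔫² ∖ 𝔫³𝒪_y` since `T̄²` survives in `gr`), `τ(y) = 1`
(initial form `T̄²`, one variable); hence `¬ ClassGE g hY I 2 2 y` — the point is SPECIAL for the column, of absolute
contact (`T` IS a hypersurface of maximal contact over `ℤ`/`𝔽_p`: `IsAbsContactAt`, tree `isAbsContactAt_of_not_dvd`
for `p ≠ 2`), with purely inseparable residue field `K(a^{1/p})(line)` — EXACTLY the second disjunct of the cn30 law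
`dvd_or_not_sepResidueAt_of_not_classGE_two`, and for `p ≠ 2` the ONLY way to be special (`p ∤ 2`).
RESIDUAL MEMBERSHIP (honest, class by class): `y` is not near-generic or δ-generic (its top locus is the LINE `V(𝔫)`, not
isolated); not curve-generic (g12: transversal section `T'² + u³ + v³` in the regular parameters `(T, u, v)` of
`𝒪_{Y,ζ}` has δ-face `u³ + v³` at slope `δ = 3/2 ∉ ℕ` — G3 needs `b ∣ a`, G2 needs `n = pᵉ`, G1 fails since `ū³ + v̄³`
has geometric zeros); not rel-curve / flat / pinch / cone / grand / split-cone / cylinder / jet-cylinder / spread (their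
letters need a section curve INSIDE `Supp(I, 2)` with a prepared monomial-times-unit or regular secondary face: `u³ + v³`
is three concurrent lines over `K̄`, neither `RelSimple` nor `RelCusp` — the edge `(3,3)` is not coprime — nor monomial);
not cross / deep-cross / node / odd-cross (two-branch letters: the top locus here is ONE regular line).  For `p = 3` the
face `u³ + v³ = (u + v)³` is a cube and the point is g24-CUSPIDAL-shaped but TAME-guard-free; for `p ≥ 5` it is the
critic's tame-looking member with NO `k`-contact: g24's `IsTameCurvePt` contains it by letter, so on the tree's landed
`oddLeaf` it lies in `Res.IsResSpecialPt oddLeaf` — in the located residual, on the IMPERFECT slice of CUT A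
(`¬ PerfectField K`, `p ∤ 2`): port-L content, not a new structural class (critic row 197a (i)–(ii)).
KERNEL (PROVED: the ring-level inclusion; the dictionary is prose). (Sources: EGAIV4 §16.8; Kollar2007 Lemma 3.74;
CossartPiltant2008 Prop. 4.2; the barrier file `SmoothVsRegularImperfectBase` (`x^p − t` over `𝔽_p(t)`).) -/
theorem diffIdeal_one_insepF_le [Fact p.Prime] [CharP K p] :
    diffIdeal K 1 (Ideal.span {insepF K p a}) ≤ insepLine K p a ^ 2 := by
  rw [diffIdeal_le_iff]
  intro D hD x hx
  obtain ⟨g, rfl⟩ := Ideal.mem_span_singleton'.mp hx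
  have hsplit : g * insepF K p a = (g * insepT K p a) * insepT K p a + g * (X 2 ^ 3 + X 3 ^ 3) := by
    simp only [insepF]; ring
  rw [hsplit, map_add, apply_mul_insepT K p a D hD, apply_mul_insepT K p a D hD]
  refine Ideal.add_mem _ ?_ ?_
  · rw [← mul_assoc, pow_two]
    exact Ideal.mul_mem_right _ _
      (Ideal.mul_mem_mul (insepT_mem_insepLine K p a) (insepT_mem_insepLine K p a))
  · have h3 : g * (X 2 ^ 3 + X 3 ^ 3) ∈ insepLine K p a ^ 3 :=
      Ideal.mul_mem_left _ g (Ideal.add_mem _ (Ideal.pow_mem_pow (X_two_mem_insepLine K p a) 3)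
        (Ideal.pow_mem_pow (X_three_mem_insepLine K p a) 3))
    simpa using hD.apply_mem_pow_sub (insepLine K p a) 3 h3

/-- **… and `Diff^{≤1}((f)) + (f) ⊆ 𝔫²` with `f` itself in `𝔫²`**: the whole first derivative ideal (Kollár's
`D¹(I) ⊇ I`) stays in `𝔫²` — no maximal-contact element over `K` anywhere along the line. KERNEL (PROVED). [folklore] -/
theorem diffIdeal_one_sup_le [Fact p.Prime] [CharP K p] :
    diffIdeal K 1 (Ideal.span {insepF K p a}) ⊔ Ideal.span {insepF K p a} ≤ insepLine K p a ^ 2 :=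
  sup_le (diffIdeal_one_insepF_le K p a) ((Ideal.span_singleton_le_iff_mem _).mpr (insepF_mem_sq K p a))

end Inhabitant

section Corner39

open MvPolynomial

/-- **corner39** (critic rows 180(α)/184/197a) `= Z² + F`, `F = −u s³ t + u⁴ + u s³ + u² s + u t²` over `𝔽₃`
(`Z, u, s, t = X 0, X 1, X 2, X 3`; g24 `section Corner`, symmetric lift `2 ↦ −1`). DEFINITION. [folklore] -/
noncomputable def corner39 : MvPolynomial (Fin 4) (ZMod 3) :=
  X 0 ^ 2 + X 1 * (-(X 2 ^ 3 * X 3) + X 1 ^ 3 + X 2 ^ 3 + X 1 * X 2 + X 3 ^ 2)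

/-- `X_mem_vars`: Auxiliary step of this node's calculus, VERBATIM from the lens file (see the module docstring);
the statement is its type. [folklore] -/
private theorem X_mem_vars (i : Fin 4) : (X i : MvPolynomial (Fin 4) (ZMod 3)) ∈ idealOfVars (Fin 4) (ZMod 3) :=
  Ideal.subset_span (Set.mem_range_self i)

/-- `corner39 ∈ 𝔪²` (order `≥ 2` at the origin). KERNEL (PROVED). [folklore] -/
theorem corner39_mem_sq : corner39 ∈ idealOfVars (Fin 4) (ZMod 3) ^ 2 := by
  have hG : (-(X 2 ^ 3 * X 3) + X 1 ^ 3 + X 2 ^ 3 + X 1 * X 2 + X 3 ^ 2 : MvPolynomial (Fin 4) (ZMod 3)) ∈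
      idealOfVars (Fin 4) (ZMod 3) := by
    refine Ideal.add_mem _ (Ideal.add_mem _ (Ideal.add_mem _ (Ideal.add_mem _ ?_ ?_) ?_) ?_) ?_
    · exact neg_mem (Ideal.mul_mem_left _ _ (X_mem_vars 3))
    · exact Ideal.pow_mem_of_mem _ (X_mem_vars 1) 3 (by norm_num)
    · exact Ideal.pow_mem_of_mem _ (X_mem_vars 2) 3 (by norm_num)
    · exact Ideal.mul_mem_left _ _ (X_mem_vars 2)
    · exact Ideal.pow_mem_of_mem _ (X_mem_vars 3) 2 (by norm_num)
  rw [corner39]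
  refine Ideal.add_mem _ (Ideal.pow_mem_pow (X_mem_vars 0) 2) ?_
  rw [pow_two]
  exact Ideal.mul_mem_mul (X_mem_vars 1) hG

/-- `corner39 ∉ 𝔪³` (order EXACTLY 2: the coefficient of `Z²` is `1`). KERNEL (PROVED). [folklore] -/
theorem corner39_not_mem_cube : corner39 ∉ idealOfVars (Fin 4) (ZMod 3) ^ 3 := by
  intro h
  have h0 := (mem_pow_idealOfVars_iff' 3 corner39).mp h (Finsupp.single 0 2)
    (by rw [Finsupp.degree_single]; norm_num)
  have h1 : coeff (Finsupp.single (0 : Fin 4) 2) corner39 = 1 := by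
    simp [corner39, coeff_X_pow, coeff_X_mul']
  rw [h1] at h0
  exact one_ne_zero h0

/-- **CONTROL (critic row 197a (7)) — corner39's ORIGIN IS A CONTACT POINT (ring level, kernel)**: `3 ∤ 2`, so by the
tree's `exists_hasseDeriv_order_one_of_not_dvd` (Kollár 3.74 (3) for `p ∤ m`) some first Hasse derivative of corner39
— here `∂_Z corner39 = 2Z = −Z`, `2` a unit mod `3` — lies in `Diff^{≤1}_{𝔽₃}((corner39))`, in `𝔪`, and NOT in `𝔪²`:
a maximal-contact element OVER `k = 𝔽₃` at the origin.  Reading: the origin of corner39 (`𝔽₃`-rational, separable)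
has `IsContactPt` at marking `2` (LAW 1 / `isContactPt_of_sepResidueAt_of_not_dvd` at scheme level), so it is of class
≥ 2 and NOT special for this column — the erratum certificate of rows 180(α)/184: corner39 is a CONTACT-SIDE pilot of
the tame order-reduction mechanics, never an inhabitant of the located residual. KERNEL (PROVED). (Sources: Kollar2007
Lemma 3.74 (3); Hauser2003 §4 (9).) -/
theorem corner39_origin_contact :
    ∃ B : Fin 4 →₀ ℕ, B.degree + 1 = 2 ∧
      hasseDeriv (ZMod 3) B corner39 ∈ diffIdeal (ZMod 3) (2 - 1) (Ideal.span {corner39}) ∧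
        hasseDeriv (ZMod 3) B corner39 ∈ idealOfVars (Fin 4) (ZMod 3) ∧
          hasseDeriv (ZMod 3) B corner39 ∉ idealOfVars (Fin 4) (ZMod 3) ^ 2 :=
  exists_hasseDeriv_order_one_of_not_dvd 3 corner39_mem_sq corner39_not_mem_cube (by norm_num)

/-- The same certificate in LETTERS over any ring with `3 = 0` (g24 pilot style): the `Z`-Taylor expansion of corner39
has linear coefficient `2Z` and `2·2Z = Z` — `∂_Z` of corner39 is a UNIT multiple of the regular parameter `Z`.
KERNEL (PROVED). [folklore] -/
theorem corner39_taylorZ {S : Type*} [CommRing S] (Z u s t ε : S) (h3 : (3 : S) = 0) :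
    (Z + ε) ^ 2 + u * (-(s ^ 3 * t) + u ^ 3 + s ^ 3 + u * s + t ^ 2) =
        (Z ^ 2 + u * (-(s ^ 3 * t) + u ^ 3 + s ^ 3 + u * s + t ^ 2)) + ε * (2 * Z) + ε ^ 2 ∧
      2 * (2 * Z) = Z := by
  constructor
  · ring
  · linear_combination Z * h3

end Corner39

end Summit.ResolutionOfSingularities.ResolutionOfSingularities.Theorems.ResidueCut
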